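import Summits.QuantumFields.YangMills.Theorems.BalabanUVNodesN08AtRecord9CB10
import Literature.MathematicalPhysics.QuantumFieldTheory.Balaban1983to89.Node00.Record11Carriers
import Literature.MathematicalPhysics.QuantumFieldTheory.Balaban1983to89.Node00.CarriersB10Prime
import Literature.MathematicalPhysics.QuantumFieldTheory.Balaban1983to89.Node00.Record11CarriersB8

/-!
# BalabanUVNodes ∕ N08 «RELATIVE TO THE PRINTED (5)» — [Balaban1985UV3] Thm 2 ((41), (47)) in the ∃-representation reading IS per-run
# cluster-expansion data (kernel, both ways); the `b10` slot of record splits EXACTLY as «Thm 1 (5), compact reading» ∧ «per-run data»; N08 at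
# the ₉CB10 ∕ ₁₁CB10YZW records closes RELATIVE to (5) (Track A, DAG node N08 = [Balaban1985UV3] CMP 102 (1985) 255, Thm 1 p. 257 (bounds (5))
# + Thm 2 p. 272 ((41), (47)); cell `pub-ymgap`, R141 (C) fan-out seat `pub-ymgap-dag-n08-e`, FAN-OUT v1.1 §N08 row s3 «alternative currency»;
# `--supports` K1 `StabilityBAtRecordR11e`)

WHAT PRINT SAYS.  Thm 2 p. 272: «The sequence of densities ρ_k defined by the inductive equations (2), with ρ₀ given by (1), satisfies the
inequalities (41), (47).»; Thm 1 p. 257: «… the sequence of densities ρ_k … satisfies the bounds (5).» with p. 257 L1 «and the constant O(1) is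
independent of ε, k, g_k in a bounded set»; Sect. D p. 272: «We have to show that the inequalities (41), (47) imply Theorem 1, i.e. the
inequalities (5).»

THE CURRENCY OF THIS FILE.  At a record of NODE 00 the `b10` leaf IS the slot `Node00.PrintedUV3V N L = ∃ 𝔗, PrintedUV3G N L (runObjects₀T N 𝔗 𝔅)`
(`Node00.leaf_b10_iff_of_isRecordOfRecord₉CB10`), and `PrintedUV3G N L R₀ = ∃ c, c.Adm ∧ (Thm1PrintedCompact ∧ Thm2Printed) (runsAtG N R₀ c)` reads
Thm 2 in the ∃-REPRESENTATION READING `B10RunsOfRecord.Repr41_47G N R₀ c S k` («there are Sect. B tower objects `W` EXTENDING the run objects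
`R₀ c S`, whose pieces carry a `B10Assembly.LeafSystem C`, with (41)_k ∧ (47)_k» — the constants `C` being quantified PER (S, k)).  Since the tree
PROVES Thm 2 on leaf systems (`B10Assembly.thm2_of_leafSystem`: (1)₀ + the fourteen step leaves ⇒ (41)_k ∧ (47)_k for every k ≤ K; the slot
binding `LeafSystem.spec`), the (41)_k ∧ (47)_k clauses of the reading are AUTOMATIC and the reading collapses (§1, kernel, both directions) to

  «PER-RUN DATA»  `∀ S : Family L c.eps0, ∃ C W, W.toRunObjects = R₀ c S.1 ∧ Nonempty (B10Assembly.LeafSystem C W.pin.toTowerRun)`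

— for every lattice approximation of the family, SOME tower objects over the run's binders with SOME leaf system (constants free per run).  Hence
(§1–§2) the slot splits EXACTLY: `b10AtG N R₀ c ↔ Thm1PrintedCompact (runsAtG N R₀ c) ∧ per-run data`, `PrintedUV3V N L ↔ ∃ 𝔗 c, c.Adm ∧
Thm1PrintedCompact (…) ∧ per-run data`.  READING (FAN-OUT §N08 s3 «Thm 1 (5) admitted as located hypothesis, Thm 2 proved»): once per-run
representation data are in hand — what a run-by-run construction delivers (the d = 3 lane's `BalabanUVNodesN08Constructed` towers, one lattice
approximation at a time) —, THE ONE LOCATED HYPOTHESIS LEFT in N08's slot is Thm 1's bounds (5) in the compact reading, i.e. exactly print's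
uniformity clause «O(1) independent of ε, k» (p. 257 L1); §3 re-keys N08's closers of record (`Node00.b10_main_of_isRecordOfRecord₉CB10`, n08-a's
`s_N08_of_refines₉CB10`, node00-def's ₁₁ face `Node00.b10_main_iff_of_isRecordOfRecord₁₁CB10YZW`) to this currency BY NAME.

WHAT IS NOT AUTOMATIC (the other direction, kernel witness in the companion Literature module `B10LargeFieldConstFamily`, filed separately by this
seat): per-run data do NOT give (5) even in the compact reading — a family of tower runs each carrying a leaf system with PER-RUN constants
(large-field O(1) `d_i = i`, pp. 273–274), couplings in (0, 1], has `Thm2Printed` and `¬ Thm1PrintedCompact`; (5) follows from per-run data only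
when the leaf constants are UNIFORM across the family (`B10RunsOfRecord.b10AtG_of_uniformLeafSystems`, here `thm1Compact_runsAtG_of_uniformLeafSystemsG`).
So «relative to (5)» is an honest residual, not a relabelling of the whole slot.

HONEST FRAMING: count-neutral kernel bookkeeping BY NAME over landed modules (`B10RunsOfRecord` v1.2, `Node00.CarriersB10`, `Node00.Record11Carriers`,
`B10Assembly`, `Balaban1985CMP102.SectB`, n08-a's `BalabanUVNodesN08AtRecord9CB10`); THEOREMS ONLY (0 def, 0 instance); N08 NOT discharged; neither
(5) nor the per-run data are asserted; one finite T⁴ programme at fixed ε with the d = 3 lattices of [B10] inside the record; nothing continuum ∕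
ℝ⁴ ∕ OS ∕ mass gap ∕ Clay.
-/

noncomputable section

namespace Summit.QuantumFields.YangMills.Theorems.BalabanUVNodesN08RelativeTo5

open Literature.MathematicalPhysics.QuantumFieldTheory.Balaban1983to89
open Literature.MathematicalPhysics.QuantumFieldTheory.Balaban1983to89.T4Continuum (T4Family FiniteEpsData)
open Literature.MathematicalPhysics.QuantumFieldTheory.Balaban1983to89.DagBinding (WorldP leavesP)
open Literature.MathematicalPhysics.QuantumFieldTheory.Balaban1983to89.Node00
open Literature.MathematicalPhysics.QuantumFieldTheory.Balaban1983to89.B10RunsOfRecord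
  (Consts Repr41_47G withReprSlot runsAtG b10AtG PrintedUV3G UniformLeafSystemsG runObjects₀T Backgrounds b10AtG_of_uniformLeafSystems)
open Literature.MathematicalPhysics.QuantumFieldTheory.Balaban1985CMP102
open Literature.MathematicalPhysics.QuantumFieldTheory.Balaban1985CMP102.Setting
open Literature.MathematicalPhysics.QuantumFieldTheory.Balaban1985CMP102.Theorems (Family)
open Summit.QuantumFields.YangMills.BalabanUVNodes.N08AtRecord9CB10 (s_N08_of_refines₉CB10 s_N08_of_refines₉CB10_at)
open YMDAG.UVSplit (RecordPred Datum S_N08)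

/-! ## §1 THE GENERIC PIN `R₀` — Thm 2 in the ∃-representation reading ⟺ per-run data; the slot splits as (5)-compact ∧ per-run data -/

section GenericPin

variable (N : ℕ) [NeZero N] {L : ℕ} (R₀ : Consts L → ∀ S : Scales L, RunObjects S (SU N)) (c : Consts L)

/-- **Thm 2 is PROVED on a leaf system, in the ∃-representation reading**: tower objects `W` extending the binders `R₀ c S` whose pinned tower run
carries a `B10Assembly.LeafSystem C` satisfy `Repr41_47G N R₀ c S k` for EVERY `k ≤ K` — the (41)_k ∧ (47)_k clauses by `B10Assembly.thm2_of_leafSystem`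
(the one-member family) read back through the binding `LeafSystem.spec`. [cite: Balaban1985UV3, Thm 2 p.272, (41) p.266, (47) p.267] -/
theorem repr41_47G_of_leafSystem {S : Scales L} {C : B10Assembly.Consts} (W : SectB.TowerObjects S (SU N))
    (hW : W.toRunObjects = R₀ c S) (LS : B10Assembly.LeafSystem C W.pin.toTowerRun) (k : ℕ) (hk : k ≤ S.K) :
    Repr41_47G N R₀ c S k := by
  have h2 : W.pin.toTowerRun.Ineq41_47 k :=
    B10Assembly.thm2_of_leafSystem (fun _ : Unit => W.pin.toTowerRun) (fun _ => LS) () k hk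
  have h' : B10.Ineq41 W.pin.toTowerRun k ∧ B10.Ineq47 W.pin.toTowerRun k := (LS.spec k).1 h2
  exact ⟨C, W, hW, ⟨LS⟩, h'.1, h'.2⟩

/-- **Thm 2 (∃-representation reading) ⇒ PER-RUN DATA**: read the representation at `k = 0` (always `≤ K`). [cite: Balaban1985UV3, Thm 2 p.272] -/
theorem perRun_of_thm2Printed_runsAtG (h : B10.Thm2Printed (runsAtG N R₀ c)) :
    ∀ S : Family L c.eps0, ∃ (C : B10Assembly.Consts) (W : SectB.TowerObjects S.1 (SU N)),
      W.toRunObjects = R₀ c S.1 ∧ Nonempty (B10Assembly.LeafSystem C W.pin.toTowerRun) := by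
  intro S
  have h0 : Repr41_47G N R₀ c S.1 0 := h S 0 (Nat.zero_le _)
  obtain ⟨C, W, hW, hLS, -, -⟩ := h0
  exact ⟨C, W, hW, hLS⟩

/-- **PER-RUN DATA ⇒ Thm 2 (∃-representation reading)**, every run and every `k ≤ K` (`repr41_47G_of_leafSystem`). [cite: Balaban1985UV3, Thm 2 p.272] -/
theorem thm2Printed_runsAtG_of_perRun
    (h : ∀ S : Family L c.eps0, ∃ (C : B10Assembly.Consts) (W : SectB.TowerObjects S.1 (SU N)),
      W.toRunObjects = R₀ c S.1 ∧ Nonempty (B10Assembly.LeafSystem C W.pin.toTowerRun)) :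
    B10.Thm2Printed (runsAtG N R₀ c) := by
  intro S k hk
  obtain ⟨C, W, hW, ⟨LS⟩⟩ := h S
  exact repr41_47G_of_leafSystem N R₀ c W hW LS k hk

/-- **THM 2 IN THE ∃-REPRESENTATION READING ⟺ PER-RUN DATA** (for the run family at the constants `c` over the binders `R₀`): «every `ρ_k`, `k ≤ K`,
admits the representation (41), (47) by Sect. B tower objects with a leaf system» ⟺ «every lattice approximation carries SOME tower objects over its
binders with SOME leaf system».  The constants of the leaf system are quantified PER RUN on both sides. [cite: Balaban1985UV3, Thm 2 p.272] -/
theorem thm2Printed_runsAtG_iff_perRun :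
    B10.Thm2Printed (runsAtG N R₀ c) ↔
      ∀ S : Family L c.eps0, ∃ (C : B10Assembly.Consts) (W : SectB.TowerObjects S.1 (SU N)),
        W.toRunObjects = R₀ c S.1 ∧ Nonempty (B10Assembly.LeafSystem C W.pin.toTowerRun) :=
  ⟨perRun_of_thm2Printed_runsAtG N R₀ c, thm2Printed_runsAtG_of_perRun N R₀ c⟩

/-- **THE SLOT AT THE CONSTANTS `c` SPLITS EXACTLY**: `b10AtG N R₀ c` (Thm 1 compact ∧ Thm 2) ⟺ «(5) in the compact reading» ∧ «per-run data».
[cite: Balaban1985UV3, Thm 1 p.257 (compact reading) + Thm 2 p.272] -/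
theorem b10AtG_iff_thm1Compact_and_perRun :
    b10AtG N R₀ c ↔
      B10.Thm1PrintedCompact (runsAtG N R₀ c) ∧
        ∀ S : Family L c.eps0, ∃ (C : B10Assembly.Consts) (W : SectB.TowerObjects S.1 (SU N)),
          W.toRunObjects = R₀ c S.1 ∧ Nonempty (B10Assembly.LeafSystem C W.pin.toTowerRun) :=
  and_congr Iff.rfl (thm2Printed_runsAtG_iff_perRun N R₀ c)

variable (L) in
/-- **THE PRINTED PAIR WITH ITS ∃-PREFIX SPLITS EXACTLY**: `PrintedUV3G N L R₀` ⟺ «∃ admissible constants `c` at which (5) holds in the compact reading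
AND every run carries representation data». [cite: Balaban1985UV3, Thm 1 p.257 (compact reading) + Thm 2 p.272, p.256 L15–18 (the ∃-prefix)] -/
theorem printedUV3G_iff_thm1Compact_and_perRun :
    PrintedUV3G N L R₀ ↔
      ∃ c : Consts L, c.Adm ∧ B10.Thm1PrintedCompact (runsAtG N R₀ c) ∧
        ∀ S : Family L c.eps0, ∃ (C : B10Assembly.Consts) (W : SectB.TowerObjects S.1 (SU N)),
          W.toRunObjects = R₀ c S.1 ∧ Nonempty (B10Assembly.LeafSystem C W.pin.toTowerRun) :=
  exists_congr fun c => and_congr Iff.rfl (b10AtG_iff_thm1Compact_and_perRun N R₀ c)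

/-- UNIFORM leaf systems (`UniformLeafSystemsG`: ONE family of constants `C` for all runs) are in particular per-run data.  The converse is FALSE
(companion module `B10LargeFieldConstFamily`: per-run constants may be unbounded along the family). [cite: Balaban1985UV3, Thm 1 p.257 L1 («independent of ε, k»)] -/
theorem perRun_of_uniformLeafSystemsG (h : UniformLeafSystemsG N R₀ c) :
    ∀ S : Family L c.eps0, ∃ (C : B10Assembly.Consts) (W : SectB.TowerObjects S.1 (SU N)),
      W.toRunObjects = R₀ c S.1 ∧ Nonempty (B10Assembly.LeafSystem C W.pin.toTowerRun) := by
  obtain ⟨C, hS⟩ := h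
  intro S
  obtain ⟨W, hW, hLS⟩ := hS S
  exact ⟨C, W, hW, hLS⟩

/-- **(5) FROM UNIFORM DATA** (Sect. D «(41), (47) imply (5)» with the O(1) of `B10Assembly.O1` — uniform because the leaf constants are): uniform leaf
systems over `R₀` at `c` give Thm 1 in the compact reading (first half of `B10RunsOfRecord.b10AtG_of_uniformLeafSystems`).  This is the ONLY way the
tree reaches (5); with per-run constants it does not (companion module). [cite: Balaban1985UV3, Thm 1 p.257, Sect. D pp.272–274] -/
theorem thm1Compact_runsAtG_of_uniformLeafSystemsG (h : UniformLeafSystemsG N R₀ c) :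
    B10.Thm1PrintedCompact (runsAtG N R₀ c) :=
  (b10AtG_of_uniformLeafSystems N R₀ c h).1

/-- **THE SLOT AT `c` RELATIVE TO (5)**: given per-run data at `c` (e.g. from a run-by-run construction), `b10AtG N R₀ c` ⟺ (5) in the compact reading.
[cite: Balaban1985UV3, Thm 1 p.257 (compact reading) + Thm 2 p.272] -/
theorem b10AtG_iff_thm1Compact_of_perRun
    (hdata : ∀ S : Family L c.eps0, ∃ (C : B10Assembly.Consts) (W : SectB.TowerObjects S.1 (SU N)),
      W.toRunObjects = R₀ c S.1 ∧ Nonempty (B10Assembly.LeafSystem C W.pin.toTowerRun)) :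
    b10AtG N R₀ c ↔ B10.Thm1PrintedCompact (runsAtG N R₀ c) :=
  (b10AtG_iff_thm1Compact_and_perRun N R₀ c).trans (and_iff_left hdata)

end GenericPin

/-! ## §2 THE [B10] SLOT OF RECORD `Node00.PrintedUV3V N L` IN THIS CURRENCY -/

section Slot

variable (N : ℕ) [NeZero N] (L : ℕ)

/-- **THE SLOT OF RECORD SPLITS EXACTLY**: `Node00.PrintedUV3V N L` ⟺ «at SOME version `𝔗` of print's transformations (2) and SOME admissible constants `c`:
(5) holds in the compact reading for print's run family on SU(N) AND every lattice approximation carries representation data (Sect. B tower objects over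
print's binders with a leaf system)».  Neither side is claimed. [cite: Balaban1985UV3, Thm 1 p.257 (compact reading) + Thm 2 p.272; Balaban1985Averaging, (10) p.19] -/
theorem printedUV3V_iff_thm1Compact_and_perRun :
    PrintedUV3V N L ↔
      ∃ (𝔗 : TFamily₃ N L) (c : Consts L), c.Adm ∧
        B10.Thm1PrintedCompact (runsAtG N (runObjects₀T N 𝔗 (Backgrounds.ofPrint N L)) c) ∧
          ∀ S : Family L c.eps0, ∃ (C : B10Assembly.Consts) (W : SectB.TowerObjects S.1 (SU N)),
            W.toRunObjects = runObjects₀T N 𝔗 (Backgrounds.ofPrint N L) c S.1 ∧ Nonempty (B10Assembly.LeafSystem C W.pin.toTowerRun) :=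
  exists_congr fun 𝔗 => printedUV3G_iff_thm1Compact_and_perRun N L (runObjects₀T N 𝔗 (Backgrounds.ofPrint N L))

/-- **THE SUPPLIER FACE IN THIS CURRENCY**: a version `𝔗`, admissible constants `c`, (5) in the compact reading at `(𝔗, c)` and per-run representation
data at `(𝔗, c)` give the slot of record.  Usage: a lane END theorem delivering tower objects with a leaf system PER RUN discharges `hdata`; what it
must add for N08 is exactly `h5`. [cite: Balaban1985UV3, Thm 1 p.257 (compact reading) + Thm 2 p.272] -/
theorem printedUV3V_of_thm1Compact_perRun (𝔗 : TFamily₃ N L) (c : Consts L) (hc : c.Adm)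
    (h5 : B10.Thm1PrintedCompact (runsAtG N (runObjects₀T N 𝔗 (Backgrounds.ofPrint N L)) c))
    (hdata : ∀ S : Family L c.eps0, ∃ (C : B10Assembly.Consts) (W : SectB.TowerObjects S.1 (SU N)),
      W.toRunObjects = runObjects₀T N 𝔗 (Backgrounds.ofPrint N L) c S.1 ∧ Nonempty (B10Assembly.LeafSystem C W.pin.toTowerRun)) :
    PrintedUV3V N L :=
  (printedUV3V_iff_thm1Compact_and_perRun N L).2 ⟨𝔗, c, hc, h5, hdata⟩

/-- … and back: the slot of record yields a version and admissible constants carrying (5) (compact) and per-run data. [cite: Balaban1985UV3, Thm 1 p.257 (compact reading) + Thm 2 p.272] -/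
theorem thm1Compact_and_perRun_of_printedUV3V (h : PrintedUV3V N L) :
    ∃ (𝔗 : TFamily₃ N L) (c : Consts L), c.Adm ∧
      B10.Thm1PrintedCompact (runsAtG N (runObjects₀T N 𝔗 (Backgrounds.ofPrint N L)) c) ∧
        ∀ S : Family L c.eps0, ∃ (C : B10Assembly.Consts) (W : SectB.TowerObjects S.1 (SU N)),
          W.toRunObjects = runObjects₀T N 𝔗 (Backgrounds.ofPrint N L) c S.1 ∧ Nonempty (B10Assembly.LeafSystem C W.pin.toTowerRun) :=
  (printedUV3V_iff_thm1Compact_and_perRun N L).1 h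

/-- **UNIFORM DATA CLOSE THE SLOT OUTRIGHT** (n08-a's supplier face `printedUV3V_of_uniformLeafSystems_at`, recorded here beside the relative one for contrast:
with UNIFORM constants (5) is a consequence, with per-run constants it is the residual hypothesis). [cite: Balaban1985UV3, Thm 1 p.257, Thm 2 p.272, Sect. D pp.272–274] -/
theorem printedUV3V_of_uniformLeafSystemsG (𝔗 : TFamily₃ N L) (c : Consts L) (hc : c.Adm)
    (h : UniformLeafSystemsG N (runObjects₀T N 𝔗 (Backgrounds.ofPrint N L)) c) : PrintedUV3V N L :=
  printedUV3V_of_thm1Compact_perRun N L 𝔗 c hc (thm1Compact_runsAtG_of_uniformLeafSystemsG N _ c h)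
    (perRun_of_uniformLeafSystemsG N _ c h)

end Slot

/-! ## §3 N08 AT THE RECORDS OF RECORD, RELATIVE TO (5) — the closers of record re-keyed to this currency BY NAME -/

section Records

variable {N : ℕ} [NeZero N] {F : T4Family} {D : Datum F N} {w : WorldP}

/-- **N08 · [Balaban1985UV3] AT EVERY ₉CB10 RECORD, RELATIVE TO (5)**: if for every odd `L > 1` some version and some admissible constants carry (5) in the
compact reading together with per-run representation data, then `Dag.B10_main` holds at every run of every record of `Node00.IsRecordOfRecord₉CB10`
(node00-def g29's `Node00.b10_main_of_isRecordOfRecord₉CB10` BY NAME; in-edges unused).  NOT-A-DISCHARGE: the hypothesis is N08's object gap in split form.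
[cite: Balaban1985UV3, Thm 1 p.257 (compact reading) + Thm 2 p.272] -/
theorem b10_main_of_isRecordOfRecord₉CB10_of_thm1Compact_perRun
    (h : ∀ L : ℕ, Odd L → 1 < L → ∃ (𝔗 : TFamily₃ N L) (c : Consts L), c.Adm ∧
      B10.Thm1PrintedCompact (runsAtG N (runObjects₀T N 𝔗 (Backgrounds.ofPrint N L)) c) ∧
        ∀ S : Family L c.eps0, ∃ (C : B10Assembly.Consts) (W : SectB.TowerObjects S.1 (SU N)),
          W.toRunObjects = runObjects₀T N 𝔗 (Backgrounds.ofPrint N L) c S.1 ∧ Nonempty (B10Assembly.LeafSystem C W.pin.toTowerRun))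
    (hR : IsRecordOfRecord₉CB10 F N D w) (P : B12.RunParams) : Dag.B10_main (leavesP w P) :=
  b10_main_of_isRecordOfRecord₉CB10 (fun L hO hL => (printedUV3V_iff_thm1Compact_and_perRun N L).2 (h L hO hL)) hR P

/-- **`S_N08 Rec` FOR EVERY RECORD PREDICATE REFINING ₉CB10, RELATIVE TO (5)** (n08-a's `s_N08_of_refines₉CB10` BY NAME). [cite: Balaban1985UV3, Thm 1 p.257 (compact reading) + Thm 2 p.272] -/
theorem s_N08_of_refines₉CB10_of_thm1Compact_perRun (Rec : RecordPred N)
    (href : ∀ (F : T4Family) (D : Datum F N) (w : WorldP), Rec F D w → IsRecordOfRecord₉CB10 F N D w)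
    (h : ∀ L : ℕ, Odd L → 1 < L → ∃ (𝔗 : TFamily₃ N L) (c : Consts L), c.Adm ∧
      B10.Thm1PrintedCompact (runsAtG N (runObjects₀T N 𝔗 (Backgrounds.ofPrint N L)) c) ∧
        ∀ S : Family L c.eps0, ∃ (C : B10Assembly.Consts) (W : SectB.TowerObjects S.1 (SU N)),
          W.toRunObjects = runObjects₀T N 𝔗 (Backgrounds.ofPrint N L) c S.1 ∧ Nonempty (B10Assembly.LeafSystem C W.pin.toTowerRun)) :
    S_N08 Rec :=
  s_N08_of_refines₉CB10 Rec href (fun L hO hL => (printedUV3V_iff_thm1Compact_and_perRun N L).2 (h L hO hL))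

/-- **Per-record form**: `S_N08 Rec` for `Rec` refining ₉CB10, the relative hypothesis asked ONLY at the block sizes the records of `Rec` present
(n08-a's `s_N08_of_refines₉CB10_at` BY NAME). [cite: Balaban1985UV3, Thm 1 p.257 (compact reading) + Thm 2 p.272] -/
theorem s_N08_of_refines₉CB10_of_thm1Compact_perRun_at (Rec : RecordPred N)
    (href : ∀ (F : T4Family) (D : Datum F N) (w : WorldP), Rec F D w → IsRecordOfRecord₉CB10 F N D w)
    (h : ∀ (F : T4Family) (D : Datum F N) (w : WorldP), Rec F D w → ∀ L : ℕ, w.L = (L : ℝ) →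
      ∃ (𝔗 : TFamily₃ N L) (c : Consts L), c.Adm ∧
        B10.Thm1PrintedCompact (runsAtG N (runObjects₀T N 𝔗 (Backgrounds.ofPrint N L)) c) ∧
          ∀ S : Family L c.eps0, ∃ (C : B10Assembly.Consts) (W : SectB.TowerObjects S.1 (SU N)),
            W.toRunObjects = runObjects₀T N 𝔗 (Backgrounds.ofPrint N L) c S.1 ∧ Nonempty (B10Assembly.LeafSystem C W.pin.toTowerRun)) :
    S_N08 Rec :=
  s_N08_of_refines₉CB10_at Rec href (fun F D w hR L hwL => (printedUV3V_iff_thm1Compact_and_perRun N L).2 (h F D w hR L hwL))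

/-- **N08 AT A ₉CB10 RECORD, EXACTLY, IN THIS CURRENCY**: ⟺ «the in-edge leaves imply: ∃ version, ∃ admissible constants, (5)-compact ∧ per-run data at the
world's block size» (g29's `Node00.b10_main_iff_of_isRecordOfRecord₉CB10` rewritten by §2). [cite: Balaban1985UV3, Thm 1 p.257 + Thm 2 p.272 (the node's shape `Dag.B10_main`, bookkeeping)] -/
theorem b10_main_iff_of_isRecordOfRecord₉CB10_relative (hR : IsRecordOfRecord₉CB10 F N D w) :
    ∃ L : ℕ, (Odd L ∧ 1 < L) ∧ w.L = (L : ℝ) ∧ ∀ P : B12.RunParams,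
      (Dag.B10_main (leavesP w P) ↔
        ((leavesP w P).b5 → (leavesP w P).b6 → (leavesP w P).b7 → (leavesP w P).b8 → (leavesP w P).b9 → (leavesP w P).b11 →
          ∃ (𝔗 : TFamily₃ N L) (c : Consts L), c.Adm ∧
            B10.Thm1PrintedCompact (runsAtG N (runObjects₀T N 𝔗 (Backgrounds.ofPrint N L)) c) ∧
              ∀ S : Family L c.eps0, ∃ (C : B10Assembly.Consts) (W : SectB.TowerObjects S.1 (SU N)),
                W.toRunObjects = runObjects₀T N 𝔗 (Backgrounds.ofPrint N L) c S.1 ∧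
                  Nonempty (B10Assembly.LeafSystem C W.pin.toTowerRun))) := by
  obtain ⟨L, hL, hwL, hiff⟩ := b10_main_iff_of_isRecordOfRecord₉CB10 hR
  refine ⟨L, hL, hwL, fun P => ?_⟩
  rw [hiff P, printedUV3V_iff_thm1Compact_and_perRun N L]

/-- **N08 · [Balaban1985UV3] AT EVERY ₁₁CB10YZW RECORD (the restated route's stage), RELATIVE TO (5)** — the K1-facing form: the `Dag.B10_main` conjunct of
the `hnodes` package at a record of `Node00.IsRecordOfRecord₁₁CB10YZW` (node00-def g31's face `Node00.b10_main_iff_of_isRecordOfRecord₁₁CB10YZW` BY NAME),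
from the relative hypothesis at every odd `L > 1`; in-edges unused.  NOT-A-DISCHARGE. [cite: Balaban1985UV3, Thm 1 p.257 (compact reading) + Thm 2 p.272] -/
theorem b10_main_of_isRecordOfRecord₁₁CB10YZW_of_thm1Compact_perRun
    (h : ∀ L : ℕ, Odd L → 1 < L → ∃ (𝔗 : TFamily₃ N L) (c : Consts L), c.Adm ∧
      B10.Thm1PrintedCompact (runsAtG N (runObjects₀T N 𝔗 (Backgrounds.ofPrint N L)) c) ∧
        ∀ S : Family L c.eps0, ∃ (C : B10Assembly.Consts) (W : SectB.TowerObjects S.1 (SU N)),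
          W.toRunObjects = runObjects₀T N 𝔗 (Backgrounds.ofPrint N L) c S.1 ∧ Nonempty (B10Assembly.LeafSystem C W.pin.toTowerRun))
    (hR : IsRecordOfRecord₁₁CB10YZW F N D w) (P : B12.RunParams) : Dag.B10_main (leavesP w P) := by
  obtain ⟨L, hL, -, hiff⟩ := b10_main_iff_of_isRecordOfRecord₁₁CB10YZW hR
  exact (hiff P).2 fun _ _ _ _ _ _ => (printedUV3V_iff_thm1Compact_and_perRun N L).2 (h L hL.1 hL.2)

/-- **Per-record form at ₁₁CB10YZW**: the relative hypothesis asked only at the record's own block size `w.L`. [cite: Balaban1985UV3, Thm 1 p.257 (compact reading) + Thm 2 p.272] -/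
theorem b10_main_of_isRecordOfRecord₁₁CB10YZW_of_thm1Compact_perRun_at (hR : IsRecordOfRecord₁₁CB10YZW F N D w)
    (h : ∀ L : ℕ, w.L = (L : ℝ) → ∃ (𝔗 : TFamily₃ N L) (c : Consts L), c.Adm ∧
      B10.Thm1PrintedCompact (runsAtG N (runObjects₀T N 𝔗 (Backgrounds.ofPrint N L)) c) ∧
        ∀ S : Family L c.eps0, ∃ (C : B10Assembly.Consts) (W : SectB.TowerObjects S.1 (SU N)),
          W.toRunObjects = runObjects₀T N 𝔗 (Backgrounds.ofPrint N L) c S.1 ∧ Nonempty (B10Assembly.LeafSystem C W.pin.toTowerRun))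
    (P : B12.RunParams) : Dag.B10_main (leavesP w P) := by
  obtain ⟨L, -, hwL, hiff⟩ := b10_main_iff_of_isRecordOfRecord₁₁CB10YZW hR
  exact (hiff P).2 fun _ _ _ _ _ _ => (printedUV3V_iff_thm1Compact_and_perRun N L).2 (h L hwL)

/-- **N08 AT A ₁₁CB10YZW RECORD, EXACTLY, IN THIS CURRENCY** (g31's `Node00.b10_main_iff_of_isRecordOfRecord₁₁CB10YZW` rewritten by §2). [cite: Balaban1985UV3, Thm 1 p.257 + Thm 2 p.272 (the node's shape `Dag.B10_main`, bookkeeping)] -/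
theorem b10_main_iff_of_isRecordOfRecord₁₁CB10YZW_relative (hR : IsRecordOfRecord₁₁CB10YZW F N D w) :
    ∃ L : ℕ, (Odd L ∧ 1 < L) ∧ w.L = (L : ℝ) ∧ ∀ P : B12.RunParams,
      (Dag.B10_main (leavesP w P) ↔
        ((leavesP w P).b5 → (leavesP w P).b6 → (leavesP w P).b7 → (leavesP w P).b8 → (leavesP w P).b9 → (leavesP w P).b11 →
          ∃ (𝔗 : TFamily₃ N L) (c : Consts L), c.Adm ∧
            B10.Thm1PrintedCompact (runsAtG N (runObjects₀T N 𝔗 (Backgrounds.ofPrint N L)) c) ∧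
              ∀ S : Family L c.eps0, ∃ (C : B10Assembly.Consts) (W : SectB.TowerObjects S.1 (SU N)),
                W.toRunObjects = runObjects₀T N 𝔗 (Backgrounds.ofPrint N L) c S.1 ∧
                  Nonempty (B10Assembly.LeafSystem C W.pin.toTowerRun))) := by
  obtain ⟨L, hL, hwL, hiff⟩ := b10_main_iff_of_isRecordOfRecord₁₁CB10YZW hR
  refine ⟨L, hL, hwL, fun P => ?_⟩
  rw [hiff P, printedUV3V_iff_thm1Compact_and_perRun N L]

end Records

/-! ## §4 (v1.1). THE PRIMED SLOT `Node00.PrintedUV3V'` (node00-def g31's `CarriersB10Prime`, chair R451 (R-b)) IN THE SAME CURRENCY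

v1.1 (same seat, 2026-08-26; APPEND-ONLY — §1–§3 byte-identical; two imports added: `Node00.CarriersB10Prime`, `Node00.Record11CarriersB8`).  The primed slot
quantifies the printed pair over an ADMISSIBLE averaging family `𝔞` of print's axiomatic class and a version family `𝔗` along it, at print's backgrounds read at
`𝔞`: `∃ 𝔞 (adm) 𝔗, PrintedUV3G N L (runObjects₀A N 𝔞 𝔗 (Backgrounds.ofAvg N L 𝔞))`.  §1's generic iff at `R₀ := runObjects₀A N 𝔞 𝔗 (Backgrounds.ofAvg N L 𝔞)`
splits it the same way; §5 adds the closer at the [B8]-keyed record `IsRecordOfRecord₁₁CB10YZWB8` (g31's `leaves_iff_of_isRecordOfRecord₁₁CB10YZWB8` BY NAME).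
Nothing re-pointed; count-neutral; NOT a discharge. -/

section PrimedSlot

open Literature.MathematicalPhysics.QuantumFieldTheory.Balaban1983to89.B10RunsOfRecord (runObjects₀A)

variable (N : ℕ) [NeZero N] (L : ℕ)

/-- **THE PRIMED SLOT SPLITS EXACTLY**: `Node00.PrintedUV3V' N L` ⟺ «at SOME admissible averaging family `𝔞`, SOME version family `𝔗` along it and SOME
admissible constants `c`: (5) holds in the compact reading for the run family over `runObjects₀A N 𝔞 𝔗 (Backgrounds.ofAvg N L 𝔞)` AND every lattice approximation
carries representation data».  Neither side is claimed. [cite: Balaban1985UV3, Thm 1 p.257 (compact reading) + Thm 2 p.272; Balaban1987RG1, (0.4)–(0.9) p.253] -/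
theorem printedUV3V'_iff_thm1Compact_and_perRun :
    PrintedUV3V' N L ↔
      ∃ (𝔞 : AvgFamily₃ N L) (_ : AvgAdmissible₃ N 𝔞) (𝔗 : TFamilyA₃ N 𝔞) (c : Consts L), c.Adm ∧
        B10.Thm1PrintedCompact (runsAtG N (runObjects₀A N 𝔞 𝔗 (Backgrounds.ofAvg N L 𝔞)) c) ∧
          ∀ S : Family L c.eps0, ∃ (C : B10Assembly.Consts) (W : SectB.TowerObjects S.1 (SU N)),
            W.toRunObjects = runObjects₀A N 𝔞 𝔗 (Backgrounds.ofAvg N L 𝔞) c S.1 ∧ Nonempty (B10Assembly.LeafSystem C W.pin.toTowerRun) :=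
  exists_congr fun 𝔞 => exists_congr fun _ => exists_congr fun 𝔗 =>
    printedUV3G_iff_thm1Compact_and_perRun N L (runObjects₀A N 𝔞 𝔗 (Backgrounds.ofAvg N L 𝔞))

variable {N L} in
/-- **SUPPLIER FACE OF THE PRIMED SLOT IN THIS CURRENCY**: an admissible averaging family, a version along it, admissible constants, (5) in the compact reading
and per-run representation data there give `PrintedUV3V'`. [cite: Balaban1985UV3, Thm 1 p.257 (compact reading) + Thm 2 p.272; Balaban1987RG1, (0.4)–(0.9) p.253] -/
theorem printedUV3V'_of_thm1Compact_perRun {𝔞 : AvgFamily₃ N L} (h𝔞 : AvgAdmissible₃ N 𝔞) (𝔗 : TFamilyA₃ N 𝔞) (c : Consts L) (hc : c.Adm)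
    (h5 : B10.Thm1PrintedCompact (runsAtG N (runObjects₀A N 𝔞 𝔗 (Backgrounds.ofAvg N L 𝔞)) c))
    (hdata : ∀ S : Family L c.eps0, ∃ (C : B10Assembly.Consts) (W : SectB.TowerObjects S.1 (SU N)),
      W.toRunObjects = runObjects₀A N 𝔞 𝔗 (Backgrounds.ofAvg N L 𝔞) c S.1 ∧ Nonempty (B10Assembly.LeafSystem C W.pin.toTowerRun)) :
    PrintedUV3V' N L :=
  (printedUV3V'_iff_thm1Compact_and_perRun N L).2 ⟨𝔞, h𝔞, 𝔗, c, hc, h5, hdata⟩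

/-- … and back: the primed slot yields an admissible averaging, a version, admissible constants, (5) (compact) and per-run data there.
[cite: Balaban1985UV3, Thm 1 p.257 (compact reading) + Thm 2 p.272; Balaban1987RG1, (0.4)–(0.9) p.253] -/
theorem thm1Compact_and_perRun_of_printedUV3V' (h : PrintedUV3V' N L) :
    ∃ (𝔞 : AvgFamily₃ N L) (_ : AvgAdmissible₃ N 𝔞) (𝔗 : TFamilyA₃ N 𝔞) (c : Consts L), c.Adm ∧
      B10.Thm1PrintedCompact (runsAtG N (runObjects₀A N 𝔞 𝔗 (Backgrounds.ofAvg N L 𝔞)) c) ∧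
        ∀ S : Family L c.eps0, ∃ (C : B10Assembly.Consts) (W : SectB.TowerObjects S.1 (SU N)),
          W.toRunObjects = runObjects₀A N 𝔞 𝔗 (Backgrounds.ofAvg N L 𝔞) c S.1 ∧ Nonempty (B10Assembly.LeafSystem C W.pin.toTowerRun) :=
  (printedUV3V'_iff_thm1Compact_and_perRun N L).1 h

/-- **GIVEN PER-RUN DATA at an admissible `(𝔞, 𝔗, c)`, (5) in the compact reading there ALONE gives the primed slot** — the «relative to (5)» face a
run-by-run construction along an admissible averaging would use. [cite: Balaban1985UV3, Thm 1 p.257 (compact reading) + Thm 2 p.272] -/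
theorem printedUV3V'_of_thm1Compact_given_perRun {𝔞 : AvgFamily₃ N L} (h𝔞 : AvgAdmissible₃ N 𝔞) (𝔗 : TFamilyA₃ N 𝔞) (c : Consts L) (hc : c.Adm)
    (hdata : ∀ S : Family L c.eps0, ∃ (C : B10Assembly.Consts) (W : SectB.TowerObjects S.1 (SU N)),
      W.toRunObjects = runObjects₀A N 𝔞 𝔗 (Backgrounds.ofAvg N L 𝔞) c S.1 ∧ Nonempty (B10Assembly.LeafSystem C W.pin.toTowerRun)) :
    B10.Thm1PrintedCompact (runsAtG N (runObjects₀A N 𝔞 𝔗 (Backgrounds.ofAvg N L 𝔞)) c) → PrintedUV3V' N L :=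
  fun h5 => printedUV3V'_of_thm1Compact_perRun h𝔞 𝔗 c hc h5 hdata

end PrimedSlot

/-! ## §5 (v1.1). N08 AT THE [B8]-KEYED RECORD `IsRecordOfRecord₁₁CB10YZWB8`, RELATIVE TO (5) -/

section RecordB8

open Literature.MathematicalPhysics.QuantumFieldTheory.Balaban1983to89.DagBinding (B9LeafX B11Leaf)

variable {N : ℕ} [NeZero N] {F : T4Family} {D : Datum F N} {w : WorldP}

/-- **N08 · [Balaban1985UV3] AT EVERY ₁₁CB10YZWB8 RECORD, RELATIVE TO (5)** — the K1-facing form at the route's [B8]-keyed carrier record (g31's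
`Node00.leaves_iff_of_isRecordOfRecord₁₁CB10YZWB8` BY NAME: the `b10` leaf there IS `PrintedUV3V N θ.L`), from the relative hypothesis at every odd `L > 1`;
in-edges unused.  NOT-A-DISCHARGE. [cite: Balaban1985UV3, Thm 1 p.257 (compact reading) + Thm 2 p.272] -/
theorem b10_main_of_isRecordOfRecord₁₁CB10YZWB8_of_thm1Compact_perRun
    (h : ∀ L : ℕ, Odd L → 1 < L → ∃ (𝔗 : TFamily₃ N L) (c : Consts L), c.Adm ∧
      B10.Thm1PrintedCompact (runsAtG N (runObjects₀T N 𝔗 (Backgrounds.ofPrint N L)) c) ∧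
        ∀ S : Family L c.eps0, ∃ (C : B10Assembly.Consts) (W : SectB.TowerObjects S.1 (SU N)),
          W.toRunObjects = runObjects₀T N 𝔗 (Backgrounds.ofPrint N L) c S.1 ∧ Nonempty (B10Assembly.LeafSystem C W.pin.toTowerRun))
    (hR : IsRecordOfRecord₁₁CB10YZWB8 F N D w) (P : B12.RunParams) : Dag.B10_main (leavesP w P) := by
  obtain ⟨θ, lam, Mstar, ops, ζ, lamW, -, -, hl⟩ := leaves_iff_of_isRecordOfRecord₁₁CB10YZWB8 hR
  exact fun _ _ _ _ _ _ => (hl P).2.2.2.1.2 ((printedUV3V_iff_thm1Compact_and_perRun N θ.L).2 (h θ.L θ.hL.1 θ.hL.2))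

/-- **Per-record form at ₁₁CB10YZWB8**: the relative hypothesis asked only at the record's own block size `w.L`. [cite: Balaban1985UV3, Thm 1 p.257 (compact reading) + Thm 2 p.272] -/
theorem b10_main_of_isRecordOfRecord₁₁CB10YZWB8_of_thm1Compact_perRun_at (hR : IsRecordOfRecord₁₁CB10YZWB8 F N D w)
    (h : ∀ L : ℕ, w.L = (L : ℝ) → ∃ (𝔗 : TFamily₃ N L) (c : Consts L), c.Adm ∧
      B10.Thm1PrintedCompact (runsAtG N (runObjects₀T N 𝔗 (Backgrounds.ofPrint N L)) c) ∧
        ∀ S : Family L c.eps0, ∃ (C : B10Assembly.Consts) (W : SectB.TowerObjects S.1 (SU N)),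
          W.toRunObjects = runObjects₀T N 𝔗 (Backgrounds.ofPrint N L) c S.1 ∧ Nonempty (B10Assembly.LeafSystem C W.pin.toTowerRun))
    (P : B12.RunParams) : Dag.B10_main (leavesP w P) := by
  obtain ⟨θ, lam, Mstar, ops, ζ, lamW, -, hwL, hl⟩ := leaves_iff_of_isRecordOfRecord₁₁CB10YZWB8 hR
  exact fun _ _ _ _ _ _ => (hl P).2.2.2.1.2 ((printedUV3V_iff_thm1Compact_and_perRun N θ.L).2 (h θ.L hwL))

/-- **N08 AT A ₁₁CB10YZWB8 RECORD, EXACTLY, IN THIS CURRENCY AND AT THE BUNDLES OF RECORD** (g31's `nodes_iff_bundles_of_isRecordOfRecord₁₁CB10YZWB8`, the `b10`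
conjunct, rewritten by §2): `Dag.B10_main` ⟺ «[B8] leaf of record → [B9] bundle leaf → [B11] bundle leaf → ∃ version ∃ admissible constants, (5)-compact ∧ per-run
data at `θ.L`». [cite: Balaban1985UV3, Thm 1 p.257 + Thm 2 p.272 (the node's shape at the objects of record, bookkeeping)] -/
theorem b10_main_iff_bundles_of_isRecordOfRecord₁₁CB10YZWB8_relative (hR : IsRecordOfRecord₁₁CB10YZWB8 F N D w) :
    ∃ (θ : Stage11Params F N) (lam : ResidB8 θ.toStage3Params) (Mstar : ℕ) (ops : OpsY N θ.toStage3Params Mstar) (ζ : ResidZ F N),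
      θ.Admissible ∧ w.L = (θ.L : ℝ) ∧ ∀ P : B12.RunParams,
        (Dag.B10_main (leavesP w P) ↔
          (B8LeafOfRecord θ.toStage3Params lam → B9LeafX (Y9OfRecord N θ.toStage3Params Mstar ops) → B11Leaf (Z11OfRecord F N ζ) →
            ∃ (𝔗 : TFamily₃ N θ.L) (c : Consts θ.L), c.Adm ∧
              B10.Thm1PrintedCompact (runsAtG N (runObjects₀T N 𝔗 (Backgrounds.ofPrint N θ.L)) c) ∧
                ∀ S : Family θ.L c.eps0, ∃ (C : B10Assembly.Consts) (W : SectB.TowerObjects S.1 (SU N)),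
                  W.toRunObjects = runObjects₀T N 𝔗 (Backgrounds.ofPrint N θ.L) c S.1 ∧
                    Nonempty (B10Assembly.LeafSystem C W.pin.toTowerRun))) := by
  obtain ⟨θ, lam, Mstar, ops, ζ, hθ, hwL, hl⟩ := nodes_iff_bundles_of_isRecordOfRecord₁₁CB10YZWB8 hR
  refine ⟨θ, lam, Mstar, ops, ζ, hθ, hwL, fun P => ?_⟩
  rw [(hl P).2.2, printedUV3V_iff_thm1Compact_and_perRun N θ.L]

end RecordB8

end Summit.QuantumFields.YangMills.Theorems.BalabanUVNodesN08RelativeTo5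

end
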